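import Summits.BirchSwinnertonDyer.Rank1Residual.ManinAdditive.TowerUnitTwist
import Literature.NumberTheory.EllipticCurves.KatoAdditiveTwistedValueNeronIntegralitySymbolClosure
import Literature.NumberTheory.EllipticCurves.ManinConstantGamma1Gamma0Comparison
import HarnessLib
import HarnessLib.Audit.Tags

/-!
# THE Γ₁ / X₁(N)-OPTIMAL KATO ROAD to C2¹ — vocabulary and laws E-es-110, E-es-110₃, E-es-111, E-es-111♯, E-es-112
# (cell `bsd-f2-manin`, Euler-system lens, planner es g24, MEMO-es §38; typing asks T-es-37 / T-p1-g12-1; typer g17)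

HONEST FRAMING.  LENS = Euler systems / explicit reciprocity (`bsd-f2-manin-es` g24, MEMO-es §38 + §38.5-bis).  SOURCE =
HOME/es/Sketch-es-g24.lean sha16 b8e2c052260c9339 (536 l., farm rc 0 · 0 err · 0 warn · 0 sorry per es; namespace
`BsdF2ManinEsG24`), §1–§2 and the §3 node, Prop bodies VERBATIM; landed here as a STATEMENT-ONLY sibling of
`TowerUnitTwist.lean` (that theorem-carrying file sits at the 400-line cap), namespace folded to `…ManinAdditive.KatoCurve`
so that E-es-111♯ `GammaOneTowerUnitTwist p` sits next to E-an-135 `TowerUnitTwist p`.  The PROVED §0/§3/§4 edges of the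
sketch (Γ₁ period ports; the lever `not_two_dvd_maninConstant₁_of_katoFact_of_witness`;
`gammaOneOddOnBlindClasses_of_katoGamma1 : exists_isNewformOf → E-es-110 → E-es-111 → ShimuraLedger.GammaOneOddOnBlindClasses`
= C2 skeleton v14 stub 6 BY NAME; `gammaOneUnitTwistAt_of_unitTwistAt`; `gammaOneTowerUnitTwist_of_towerUnitTwist`) are
landed by the line provers under `Theorems/ManinLocalTwoThreeGammaOneKatoRoad.lean` (C2 LEAD p1 g12, ask T-p1-g12-1); E-es-111♯
itself is being PROVED by value (prover p2 g12, P-es-7: `Theorems/ManinLocalTwoThree{MultiHub,EvenSpan,Washing}PrimePow.lean`),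
after which `gammaOneTowerUnitTwist_holds` is a one-line corollary of this file's def.

WHAT IS CLAIMED (es, not the tree).
* **E-es-110 `KatoNeronIntegralTwoGamma1Optimal`** (F♯₁): the tree's datum-free body `KatoFactTwoAt V D₁.f` (Literature
  `KatoAdditiveTwistedValueNeronIntegralitySymbolClosure`, = F♯ minus exactly the `E[2]`-irreducibility binder) for every
  OPTIMAL `X₁(N)`-datum `D₁` (`D₁.IsOptimal`: `Λ_V = c₁·Λ₁(f)`, Stevens' curve).  NOT IN PRINT on the reducible locus: print
  gives it for the symbol-closure curve `E_K` / the irreducible locus only (nearest print BY NAME: Literature facts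
  `kato_neron_isIntegral_twistedSymbolSum_of_additive_two_real` (F♯, Kato 2004 Thm. 12.5) and the symbol-closure fact of the
  same Literature file (Wuthrich 2014 §3)); es §38.4 HONEST AUDIT: modulo the elementary `S_χ ∈ Λ₁ ⊗ ℤ[χ]`,
  E-es-110 ∧ E-es-111 ⟺ E-es-111 ∧ C2¹, so E-es-110 on the blind locus is «stub 6 in Euler-system clothing» (inside barrier
  `EulerSystemBigImageAtSmallImage`).  `p = 3` twin **E-es-110₃ `KatoNeronIntegralThreeGamma1Optimal`**.
* **E-es-111 `TwoAdicGammaOneWitnessLaw`** (LAW-V₁, witness form): every `X₁(N)`-optimal curve additive at `2` has an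
  admissible `χ` (F♯'s side conditions) whose Euler-corrected twisted symbol sum is a `2`-adic UNIT multiple of the generator
  of `2·re Λ₁(f)` (`GammaOneUnitTwistAt 2`, `TwoAdicGammaOneWitness`) — f-intrinsic, NO plus-index hypothesis.
* **E-es-111♯ `GammaOneTowerUnitTwist p`**: `KatoCurve.TowerUnitTwist p` VERBATIM with the binder `PlusIndexPrimeTo p f →`
  DELETED and `UnitTwistAt` replaced by `GammaOneUnitTwistAt` — THEOREM CANDIDATE (es §38.5-bis and §38.5-quater: homogenise the tree's
  `RigidityImpliesTower` from `ZMod p` to `ZMod p^(a+1)`; H2b `multiHubRigid_pow` and H4 `false_of_gamma1_plusPart_dvd_mod`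
  PROVED by es in HOME/es/g24/; prover p2 g12 took P-es-7).
* **E-es-112 `GammaOneOddAtFour`**: `2 ∤ c₁` for every `X₁(N)`-optimal datum additive at `2` (Stevens' Conjecture I′,
  2-part, additive case) — the conclusion node of the road; PROVED by es ⟸ E-es-110 ∧ E-es-111 (sketch §3).
BC5 (census witness): HOME/es/g24/E-es-110-census-v1.txt 4bc5fa30143e7192 (source POLAR-N5000-rows-v1.tsv 3b0eeb7a71360859,
kit j306897): LAW `b1 = 0` on 6160/6160 classes `4 ∣ N ≤ 5000` and 4313/4313 classes `9 ∣ N ≤ 5000` (F1/F2/F3 falsifiers: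
0 found); the Γ₁ renormalisation is non-trivial on exactly 21 classes at `2` (blind families `4(m²+4)` ×10, `16(m²+4)` ×7,
wild 32a1/128b1/128d1, + 40a1): there NO Γ₀-unit twist exists (21/21) and a Γ₁-unit twist EXISTS (21/21); at `3` trivial
except 27a1/54a1 (no `p = 3` candidate beyond LAW-V).  BC7: HOME/es/g24/Probe-es-g24.lean 175ab15c518bd5e0 4/4 CLEAN (es).
REFUTER VERDICTS: R-es-53 (ref1: §38.4 (b), §38.5 H1/H2) PENDING at filing — a repaired text lands under a NEW name (suffix
`R`), these defs keep their bodies (append-only rule).  WHY NOVEL (es): the Γ₁-normalised unit-twist law is the first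
C2-input of the cell that is non-vacuous exactly on the totally blind locus, where every Γ₀-normalised witness statement of
the tree is FALSE (21/21).  bears_on: stmt-BirchSwinnertonDyer-22967 (C2 `ManinOddAtFour`, skeleton v14 stub 6).
PARTITION (es) 0 · beyond-print theorem: no (typed LAWS + census; E-es-111♯ is a theorem CANDIDATE) · BSD is not proved by
this; Manin's conjecture is not proved; Stevens' conjecture is not proved; C2 OPEN.  Nothing in this file is asserted: the
five laws are `@[conjecture]` obligation nodes, the two auxiliary notions are definitions; no theorem, no sorry.
-/

set_option autoImplicit false

noncomputable section

open scoped Classical MatrixGroups ModularForm ComplexConjugate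

open CongruenceSubgroup Complex WeierstrassCurve Literature.NumberTheory.EllipticCurves
  Literature.NumberTheory.EllipticCurves.ModularForms
  Summit.BirchSwinnertonDyer.Rank1Residual.ManinAdditive
  Summit.BirchSwinnertonDyer.Rank1Residual.ManinAdditive.KatoCurve

namespace Summit.BirchSwinnertonDyer.Rank1Residual.ManinAdditive.KatoCurve

/-! ## §1 E-es-110 (F♯₁): Kato–Néron integrality AT THE X₁(N)-OPTIMAL CURVE -/

/-- **E-es-110 (F♯₁) — Kato–Néron integrality of the Euler-corrected twisted symbol sums at the `X₁(N)`-OPTIMAL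
curve** (verbatim `BsdF2ManinEsG24.KatoNeronIntegralTwoGamma1Optimal`).  For a globally minimal elliptic `V/ℚ` carrying an
OPTIMAL `X₁(N)`-datum `D₁` (`D₁.IsOptimal`: `Λ_V = c₁·Λ₁(f)`, i.e. `V` is Stevens' curve `E₁ = ℂ/Λ₁(f)` of its class), the
tree's datum-free body `KatoFactTwoAt V D₁.f` holds: `V` additive at `2`, `(m, 2N) = 1`, `χ` primitive, `χ ≠ 1`, `2 ∤ ord χ`,
`χ(8) ≠ 1`, `ϖ·Ω(V) = Ω⁺_f`, `e_χ·Σ_a χ(a){∞,a/m}_f = r·Ω⁺_f` ⟹ `s·ϖ·r ∈ ℤ̄` for some odd `s`.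
DERIVATION (es) = F♯'s (Q1)–(Q8) (Kato 2004 Thm 12.5 (1) / (8.1.3) / Thm 6.6 / Thm 9.7 + explicit reciprocity at additive `2`)
with the (Q8) lattice-admissibility clause — the ONLY place F♯ uses `W[2]` irreducible — replaced by its source, Wuthrich 2014 §3:
`V_ℤ(f) ⊇ H₁(E₁(ℂ), ℤ)` for the `X₁(N)`-optimal curve `E₁` itself (no image hypothesis).  Statement-only VARIANT candidate
(same epistemic status and size as F♯ = C2 skeleton v14 stub 1); NOT in print on the reducible locus (es §38.4), NOT a tree fact.
TYPER FRAMING (E-es-110): lens es; LAW (obligation node), nothing asserted; BC5 / REF1 status in the module docstring.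
[cite: Kato2004Asterisque, Thm. 12.5 (1) (p. 221), (8.1.3) (p. 180), Thm. 6.6 (1) (p. 163) (shape only; the X₁-optimal variant is NOT in print — cell memo MEMO-es §38)]
[cite: Wuthrich2014, §3 (V_Z(f) contains H_1(E_1(C), Z)) (shape only)] -/
@[conjecture]
def KatoNeronIntegralTwoGamma1Optimal : Prop :=
  ∀ (V : WeierstrassCurve ℚ) [V.IsElliptic] [V.IsGloballyMinimal] {N : ℕ} [NeZero N]
    (D₁ : Gamma1ParametrizationData V N), D₁.IsOptimal → KatoFactTwoAt V D₁.f

/-- **E-es-110₃ (F₃♮₁ / F₃₁)** — the `p = 3` twin (verbatim `BsdF2ManinEsG24.KatoNeronIntegralThreeGamma1Optimal`):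
`KatoFactThreeAt V D₁.f` for every optimal `X₁(N)`-datum.  BC5: `b1_3 = 0` on 4313/4313 classes `9 ∣ N ≤ 5000`; the Γ₁
renormalisation at `3` is trivial except on 27a1/54a1.  TYPER FRAMING (E-es-110₃): lens es; LAW (obligation node), nothing asserted.
[cite: Kato2004Asterisque, (8.1.3) (p. 180), Thm. 6.6 (1) (p. 163), Thm. 9.7 (p. 189), Thm. 12.6 (2) (p. 222) (shape only; NOT in print at the X₁-optimal curve — cell memo MEMO-es §38)] -/
@[conjecture]
def KatoNeronIntegralThreeGamma1Optimal : Prop :=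
  ∀ (V : WeierstrassCurve ℚ) [V.IsElliptic] [V.IsGloballyMinimal] {N : ℕ} [NeZero N]
    (D₁ : Gamma1ParametrizationData V N), D₁.IsOptimal → KatoFactThreeAt V D₁.f

/-! ## §2 E-es-111 (LAW-V₁): the Γ₁-UNIT TWIST -/

/-- **`GammaOneUnitTwistAt p V f χ`** — the Γ₁ twin of `KatoCurve.UnitTwistAt` (verbatim
`BsdF2ManinEsG24.GammaOneUnitTwistAt`): the Euler-corrected twisted symbol sum `e_χ·Σ_a χ(a){∞,a/m}_f` is `r·(2 re y)` with
`s·r/p ∉ ℤ̄` for all `s` prime to `p` (a `p`-adic UNIT against the Γ₁-plus-period) for some `y ∈ Λ₁(f) = periodLatticeGamma1 f`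
whose real part is non-zero and GENERATES `re Λ₁(f)`.  (A definition; Stevens 1989 §2 for `Λ₁(f)` and the `X₁(N)`-optimal curve.)
[cite: Stevens1989, §2 (shape only: the Γ₁ period lattice; the unit-twist notion is the cell's — MEMO-es §38)] -/
def GammaOneUnitTwistAt (p : ℕ) (V : WeierstrassCurve ℚ) [V.IsElliptic] {N : ℕ} [NeZero N]
    (f : CuspForm (Gamma0 N) 2) {m : ℕ} [NeZero m] (χ : DirichletCharacter ℂ m) : Prop :=
  ∃ (r : ℂ) (y : ℂ), y ∈ periodLatticeGamma1 f ∧ y.re ≠ 0 ∧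
    (∀ x ∈ periodLatticeGamma1 f, ∃ j : ℤ, x.re = j * y.re) ∧
    (∏ ℓ ∈ N.primeFactors with ¬ ℓ ^ 2 ∣ N,
        (((ℓ : ℂ) - (V.LFunction ℓ : ℂ) * χ (ℓ : ZMod m)) *
          ((ℓ : ℂ) - (V.LFunction ℓ : ℂ) * (χ (ℓ : ZMod m))⁻¹))) *
        twistedSymbolSum f χ = r * ((2 * y.re : ℝ) : ℂ) ∧
    ∀ s : ℕ, ¬ p ∣ s → ¬ _root_.IsIntegral ℤ ((s : ℂ) * r / p)

/-- **The 2-adic Γ₁ WITNESS of `(V, f)`** (verbatim `BsdF2ManinEsG24.TwoAdicGammaOneWitness`): an admissible `χ` with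
F♯'s side conditions (`(m, 2N) = 1`, primitive, `χ ≠ 1`, odd order, `χ(8) ≠ 1`) carrying a Γ₁-unit twist at `2`.  (A definition.)
[cite: Kato2004Asterisque, Thm. 12.5 (1) (p. 221) (shape only: the side conditions on χ are those of the tree fact F♯)] -/
def TwoAdicGammaOneWitness (V : WeierstrassCurve ℚ) [V.IsElliptic] {N : ℕ} [NeZero N]
    (f : CuspForm (Gamma0 N) 2) : Prop :=
  ∃ (m : ℕ) (_ : NeZero m) (χ : DirichletCharacter ℂ m),
    m.Coprime (2 * N) ∧ χ.IsPrimitive ∧ χ ≠ 1 ∧ ¬ 2 ∣ orderOf χ ∧ χ (8 : ZMod m) ≠ 1 ∧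
    GammaOneUnitTwistAt 2 V f χ

/-- **E-es-111 (LAW-V₁ at `p = 2`, witness form) `TwoAdicGammaOneWitnessLaw`** (verbatim
`BsdF2ManinEsG24.TwoAdicGammaOneWitnessLaw`): every `X₁(N)`-optimal curve additive at `2` has a 2-adic Γ₁ witness for its
newform.  The f-intrinsic `Λ₁(f)`-wording of MEMO-es §31 LAW-V («some allowed `χ` has `e_χ S_χ` generating `(Λ₁(f) ⊗ ℤ₂[χ])⁺`»),
with NO plus-index hypothesis.  BC5: POLAR-N5000 `b1_2 = 0` on 6160/6160 classes `4 ∣ N ≤ 5000`; non-trivially Γ₁ on 21/21.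
NOT in print (nearest print BY NAME: the tree's Γ₀-normalised witness notion `TwoAdicWitnessOfPlusIndexOdd` / theorem
`twoAdicWitness_of_towerUnitTwist`, which are vacuous or false on the blind locus).  TYPER FRAMING (E-es-111): lens es; LAW
(obligation node), nothing asserted.
[cite: Stevens1989, §2 (shape only: X₁(N)-optimal curve and Λ₁(f); the law is the cell's — MEMO-es §38, NOT in print)] -/
@[conjecture]
def TwoAdicGammaOneWitnessLaw : Prop :=
  ∀ (V : WeierstrassCurve ℚ) [V.IsElliptic] [V.IsGloballyMinimal] {N : ℕ} [NeZero N]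
    (D₁ : Gamma1ParametrizationData V N), D₁.IsOptimal →
    ¬ V.HasGoodReductionAtPrime 2 → ¬ V.HasMultiplicativeReductionAtPrime 2 →
    TwoAdicGammaOneWitness V D₁.f

/-- **E-es-111♯ `GammaOneTowerUnitTwist p`** — the f-intrinsic TOWER form of LAW-V₁ (verbatim
`BsdF2ManinEsG24.GammaOneTowerUnitTwist`): `KatoCurve.TowerUnitTwist p` VERBATIM with the binder `PlusIndexPrimeTo p f →`
DELETED and `UnitTwistAt` replaced by `GammaOneUnitTwistAt`: for the newform `f` of `W` and an odd prime `q ≠ p`, `q ∤ N`,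
`p ∤ (q−1)/2`, arbitrarily high in the `q`-power conductor tower there is an even primitive `χ` with a Γ₁-unit twist at `p`.
(The tree's proof of `towerUnitTwist_holds` shows, hypothesis-free, the DICHOTOMY «Γ₀-unit twist high in every admissible
`q`-tower ∨ `p ∣ [2 re Λ_f : 2 re Λ₁(f)]`»; this law asserts the Γ₁-renormalised conclusion on the second branch too.)
THEOREM CANDIDATE with an in-tree proof plan (MEMO-es §38.5-bis and §38.5-quater; prover p2 g12, P-es-7).  TYPER FRAMING (E-es-111♯):
lens es; schema in `p` (used at `p = 2` for C2, `p = 3` for C3); obligation node, nothing asserted.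
[cite: Stevens1989, §2 (shape only: Λ₁(f); the tower law is the cell's E-an-135 / MEMO-an §71.4 renormalised — NOT in print)] -/
@[conjecture]
def GammaOneTowerUnitTwist (p : ℕ) : Prop :=
  ∀ (W : WeierstrassCurve ℚ) [W.IsElliptic] {N : ℕ} [NeZero N] (f : CuspForm (Gamma0 N) 2),
    IsNewformOf W f →
    ∀ (q : ℕ) [Fact q.Prime], q ≠ 2 → q ≠ p → ¬ q ∣ N → ¬ p ∣ (q - 1) / 2 →
    ∀ n₁ : ℕ, ∃ n : ℕ, n₁ ≤ n ∧
      ∃ χ : DirichletCharacter ℂ (q ^ n), χ.IsPrimitive ∧ χ.Even ∧ GammaOneUnitTwistAt p W f χ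

/-! ## §3 E-es-112: the conclusion node `2 ∤ c₁` -/

/-- **E-es-112 `GammaOneOddAtFour` — `2 ∤ c₁` for every `X₁(N)`-optimal datum additive at `2`** (verbatim
`BsdF2ManinEsG24.GammaOneOddAtFour`; the conclusion of the Γ₁ Kato road = Stevens' Conjecture I′, 2-part, in the additive
case).  PROVED by es ⟸ E-es-110 ∧ E-es-111 (sketch §3, `gammaOneOddAtFour_of`, landed by the line provers), and
`ShimuraLedger.GammaOneOddOnBlindClasses` (C2 v14 stub 6) ⟸ this ∧ `exists_isNewformOf`.  Nearest print BY NAME: the tree's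
`X₀(N)`-side obligation `ManinConstantOne` / Literature `ManinConstantGamma1Gamma0Comparison` (`c₁ ∣ c₀`, ČNS Lemma 6.5).
TYPER FRAMING (E-es-112): lens es; node (obligation), nothing asserted.
[cite: Stevens1989, §2 (the X₁(N)-optimal curve and c₁; Stevens states c₁ = ±1 as a question — the additive 2-part here is the cell's node, NOT a printed theorem)] -/
@[conjecture]
def GammaOneOddAtFour : Prop :=
  ∀ (V : WeierstrassCurve ℚ) [V.IsElliptic] [V.IsGloballyMinimal] {N : ℕ} [NeZero N]
    (D₁ : Gamma1ParametrizationData V N), D₁.IsOptimal →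
    ¬ V.HasGoodReductionAtPrime 2 → ¬ V.HasMultiplicativeReductionAtPrime 2 →
    ¬ (2 : ℤ) ∣ D₁.maninConstant

end Summit.BirchSwinnertonDyer.Rank1Residual.ManinAdditive.KatoCurve

end
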